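import Summits.AnomalousDissipation.AnomalousDissipation.Theses.NeutralTaylorWaves
import Literature.Analysis.FunctionSpaces.TorusSpaceTime

/-!
# Stub `stub_driftAbsorption` of the line `Sketch`
# (crux stmt-AnomalousDissipation-16315, `NeutralTaylorWaves.NewtonRealisation`)

DRIFT ABSORPTION — Galilean bookkeeping on `T³`. If `(W, Q, c')` is a smooth drifting steady state of
force `f`, i.e. `W·∇W − νΔW + ∇Q − c'∂₃W = f` pointwise with `W` smooth, divergence free and mean
zero, then the time-constant field `u := W − c'e₃` (`e₃ = EuclideanSpace.single 2 1`) with the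
time-constant pressure `Q` is a classical solution of `NS_ν(f)` on `T³ × ℝ`
(`Torus.IsClassicalNSSolutionOn univ`), `‖∇u‖₂² = ‖∇W‖₂²` and `∫‖u‖² = ∫‖W‖² + c'²`:

* `∂ₜu = 0` (derivative of a constant);
* all space operators ignore the additive constant: `D(W − c) = DW` (`Torus.fderiv`), hence
  `Δ(W − c) = ΔW`, `∂ᵢ(W − c) = ∂ᵢW`, `div (W − c) = div W`;
* `(u·∇)u = DW(x)[W x − c'e₃] = W·∇W − c'∂₃W` (linearity in the transporting vector and
  `∂₃W = DW[e₃]` for `C¹` `W`), so the momentum equation of `u` is the drifting steady equation;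
* `‖W x − v₀‖² = ‖W x‖² − 2⟪v₀, W x⟫ + ‖v₀‖²`, `∫⟪v₀, W⟫ = ⟪v₀, ∫W⟫ = 0`, `volume T³ = 1`,
  `‖c'e₃‖ = |c'|`.

References: G. P. Galdi, *An Introduction to the Mathematical Theory of the Navier–Stokes Equations*
(2011), Ch. I (Galilean frames for steady flows); folklore.
-/

set_option linter.dupNamespace false
noncomputable section
open Filter Set MeasureTheory Topology
open Literature.Analysis.FunctionSpaces Literature.Analysis.FunctionSpaces.Torus
namespace Summit.AnomalousDissipation.AnomalousDissipation.Theorems.NewtonRealisation.DriftAbsorption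
/-- The flat unit three-torus (local notation). -/
local notation "𝕋³" => UnitAddTorus (Fin 3)
/-- Velocity values (local notation). -/
local notation "E³" => EuclideanSpace ℝ (Fin 3)

/-! ## Space operators of a field minus a constant -/

/-- Re-centred lift of a field minus a constant: `liftAt (g − c) x = liftAt g x − c`. [folklore] -/
theorem liftAt_sub_const {F : Type*} [NormedAddCommGroup F] (g : 𝕋³ → F) (c : F) (x : 𝕋³) :
    Torus.liftAt (fun z => g z - c) x = fun v => Torus.liftAt g x v - c :=
  rfl

/-- The torus Fréchet derivative ignores additive constants: `D(g − c)(x) = Dg(x)`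
(Mathlib `fderiv_sub_const`; no differentiability needed). [folklore] -/
theorem torusFderiv_sub_const {F : Type*} [NormedAddCommGroup F] [NormedSpace ℝ F] (g : 𝕋³ → F)
    (c : F) (x : 𝕋³) : Torus.fderiv (fun z => g z - c) x = Torus.fderiv g x := by
  simp only [Torus.fderiv, liftAt_sub_const]
  exact _root_.fderiv_sub_const c

/-- The Euclidean Laplacian ignores additive constants: `Δ(g − c) = Δg` (as `D(g − c) = Dg`
identically; no differentiability needed). [folklore] -/
theorem euclideanLaplacian_sub_const {F : Type*} [NormedAddCommGroup F] [NormedSpace ℝ F]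
    (g : E³ → F) (c : F) :
    Laplacian.laplacian (fun v => g v - c) = Laplacian.laplacian g := by
  rw [InnerProductSpace.laplacian_eq_iteratedFDeriv_stdOrthonormalBasis,
    InnerProductSpace.laplacian_eq_iteratedFDeriv_stdOrthonormalBasis]
  have h : _root_.fderiv ℝ (fun v => g v - c) = _root_.fderiv ℝ g :=
    funext fun _ => _root_.fderiv_sub_const c
  simp only [iteratedFDeriv_two_apply, h]

/-- The torus Laplacian ignores additive constants: `Δ(g − c)(x) = Δg(x)`. [folklore] -/
theorem torusLaplacian_sub_const {F : Type*} [NormedAddCommGroup F] [NormedSpace ℝ F]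
    (g : 𝕋³ → F) (c : F) (x : 𝕋³) :
    Torus.laplacian (fun z => g z - c) x = Torus.laplacian g x := by
  simp only [Torus.laplacian, liftAt_sub_const, euclideanLaplacian_sub_const]

/-- Partial derivatives ignore additive constants: `∂ᵢ(g − c)(x) = ∂ᵢg(x)` (Mathlib
`deriv_sub_const`; no differentiability needed). [folklore] -/
theorem torusPartialDeriv_sub_const {F : Type*} [NormedAddCommGroup F] [NormedSpace ℝ F]
    (i : Fin 3) (g : 𝕋³ → F) (c : F) (x : 𝕋³) :
    Torus.partialDeriv i (fun z => g z - c) x = Torus.partialDeriv i g x := by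
  simp only [Torus.partialDeriv, Torus.lineDeriv, deriv_sub_const]

/-- The divergence ignores additive constants: `div(g − c)(x) = div g(x)` (coordinatewise
`deriv_sub_const`). [folklore] -/
theorem torusDivergence_sub_const (g : 𝕋³ → E³) (c : E³) (x : 𝕋³) :
    Torus.divergence (fun z => g z - c) x = Torus.divergence g x := by
  simp only [Torus.divergence, Torus.partialDeriv, Torus.lineDeriv, PiLp.sub_apply, deriv_sub_const]

/-- Divergence-freeness survives subtracting a constant: `div W = 0 → div (W − c) = 0`. [folklore] -/
theorem isDivFree_sub_const {W : 𝕋³ → E³} (hW : IsDivFree W) (c : E³) :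
    IsDivFree (fun z => W z - c) := by
  intro x
  rw [torusDivergence_sub_const]
  exact hW x

/-- **Gradient norm of a field minus a constant**: `‖∇(W − c)‖₂² = ‖∇W‖₂²` (`∂ᵢ(W − c) = ∂ᵢW`
pointwise). [folklore] -/
theorem gradNormSq_sub_const (W : 𝕋³ → E³) (c : E³) :
    gradNormSq (fun z => W z - c) = gradNormSq W := by
  simp only [gradNormSq, torusPartialDeriv_sub_const]

/-! ## The convective term and the momentum equation of `W − c'eᵢ` -/

/-- The convective derivative of `W − c'eᵢ` along itself: `((W − c'eᵢ)·∇)(W − c'eᵢ) =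
(W·∇)W − c'∂ᵢW` for `C¹` `W` (`D(W − c) = DW`, linearity of `DW(x)` in the transporting vector,
`∂ᵢW = DW[eᵢ]`). [folklore] -/
theorem convect_sub_smul_single {W : 𝕋³ → E³} (hW : IsContDiff 1 W) (c' : ℝ) (i : Fin 3) (x : 𝕋³) :
    Torus.convect (fun y => W y - c' • EuclideanSpace.single i (1 : ℝ))
        (fun y => W y - c' • EuclideanSpace.single i (1 : ℝ)) x =
      Torus.convect W W x - c' • Torus.partialDeriv i W x := by
  simp only [Torus.convect, torusFderiv_sub_const, map_sub, map_smul,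
    partialDeriv_eq_fderiv_apply hW i x]

/-- **Drift absorption, momentum equation.** If `W·∇W − νΔW + ∇Q − c'∂₃W = f` pointwise for a `C¹`
field `W`, then the time-constant field `u := W − c'e₃` with pressure `Q` satisfies the momentum
equation of `NS_ν(f)` on `T³ × ℝ`: `∂ₜu = 0`, `(u·∇)u = W·∇W − c'∂₃W` and `Δu = ΔW`. [folklore] -/
theorem momentum_sub_drift {ν c' : ℝ} {f W : 𝕋³ → E³} {Q : 𝕋³ → ℝ} (hW : IsContDiff 1 W)
    (hf : ∀ x, Torus.convect W W x - ν • Torus.laplacian W x + Torus.gradient Q x -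
        c' • Torus.partialDeriv (2 : Fin 3) W x = f x) (t : ℝ) (x : 𝕋³) :
    Torus.timeDerivWithin Set.univ
          (fun (_ : ℝ) (y : 𝕋³) => W y - c' • EuclideanSpace.single (2 : Fin 3) (1 : ℝ)) t x +
        Torus.convect (fun y => W y - c' • EuclideanSpace.single (2 : Fin 3) (1 : ℝ))
          (fun y => W y - c' • EuclideanSpace.single (2 : Fin 3) (1 : ℝ)) x =
      ν • Torus.laplacian (fun y => W y - c' • EuclideanSpace.single (2 : Fin 3) (1 : ℝ)) x -
        Torus.gradient Q x + f x := by
  have ht : Torus.timeDerivWithin Set.univ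
      (fun (_ : ℝ) (y : 𝕋³) => W y - c' • EuclideanSpace.single (2 : Fin 3) (1 : ℝ)) t x = 0 := by
    simp [Torus.timeDerivWithin]
  rw [ht, zero_add, convect_sub_smul_single hW, torusLaplacian_sub_const, ← hf x]
  abel

/-- **Drift absorption, the classical solution.** A smooth drifting steady state `(W, Q, c')` of
force `f` (`W·∇W − νΔW + ∇Q − c'∂₃W = f`, `div W = 0`) gives the time-constant classical solution
`(W − c'e₃, Q)` of `NS_ν(f)` on `T³ × ℝ` (joint smoothness of time-constant smooth fields is
`isSmoothSpaceTimeOn_const`). [folklore] -/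
theorem isClassicalNSSolutionOn_sub_drift {ν c' : ℝ} {f W : 𝕋³ → E³} {Q : 𝕋³ → ℝ}
    (hW : IsSmooth W) (hQ : IsSmooth Q) (hdiv : IsDivFree W)
    (hf : ∀ x, Torus.convect W W x - ν • Torus.laplacian W x + Torus.gradient Q x -
        c' • Torus.partialDeriv (2 : Fin 3) W x = f x) :
    IsClassicalNSSolutionOn Set.univ ν (fun _ => f)
      (fun _ x => W x - c' • EuclideanSpace.single (2 : Fin 3) (1 : ℝ)) (fun _ => Q) := by
  have hu : IsSmooth (fun x => W x - c' • EuclideanSpace.single (2 : Fin 3) (1 : ℝ)) :=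
    hW.sub (isSmooth_const _)
  have hW1 : IsContDiff 1 W := hW.isContDiff (by simp)
  exact ⟨isSmoothSpaceTimeOn_const hu _, isSmoothSpaceTimeOn_const hQ _,
    fun t _ x => momentum_sub_drift hW1 hf t x, fun _ _ => isDivFree_sub_const hdiv _⟩

/-! ## Energy of a mean-zero field minus a constant -/

/-- **Energy of a mean-zero field minus a constant**: `∫‖W − v₀‖² = ∫‖W‖² + ‖v₀‖²` for smooth
mean-zero `W` on the probability space `T³` (`‖W − v₀‖² = ‖W‖² − 2⟪v₀, W⟫ + ‖v₀‖²`,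
`∫⟪v₀, W⟫ = ⟪v₀, ∫W⟫ = 0`, `volume T³ = 1`). [folklore] -/
theorem integral_norm_sq_sub_const {W : 𝕋³ → E³} (hW : IsSmooth W) (h0 : HasZeroMean W)
    (v₀ : E³) : ∫ x, ‖W x - v₀‖ ^ 2 = (∫ x, ‖W x‖ ^ 2) + ‖v₀‖ ^ 2 := by
  have h2 : (fun x => ‖W x - v₀‖ ^ 2) =
      fun x => (‖W x‖ ^ 2 + ‖v₀‖ ^ 2) - 2 * inner ℝ v₀ (W x) := by
    funext x
    rw [norm_sub_sq_real, real_inner_comm v₀ (W x)]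
    ring
  have hiN : Integrable (fun x => ‖W x‖ ^ 2) (volume : Measure 𝕋³) := hW.norm_sq.integrable
  have hiV : Integrable (fun _ : 𝕋³ => ‖v₀‖ ^ 2) (volume : Measure 𝕋³) := integrable_const _
  have hiNV : Integrable (fun x => ‖W x‖ ^ 2 + ‖v₀‖ ^ 2) (volume : Measure 𝕋³) := hiN.add hiV
  have hiI : Integrable (fun x => 2 * inner ℝ v₀ (W x)) (volume : Measure 𝕋³) :=
    ((isSmooth_const v₀).inner hW).integrable.const_mul 2
  have h0' : ∫ x, W x = 0 := h0
  rw [h2, integral_sub hiNV hiI, integral_add hiN hiV, integral_const, probReal_univ,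
    one_smul, integral_const_mul, integral_inner hW.integrable v₀, h0', inner_zero_right, mul_zero,
    sub_zero]

/-! ## The stub -/

/-- **DRIFT ABSORPTION** (the registered stub `stub_driftAbsorption` of the line `Sketch`, verbatim
the birth stub 3): a smooth drifting steady state `W·∇W − νΔW + ∇Q − c'∂₃W = f` (`W` smooth,
divergence free, mean zero; `Q` smooth) gives the time-constant classical solution `u = W − c'e₃` of
`NS_ν(f)` on `T³ × ℝ`, with `‖∇u‖₂² = ‖∇W‖₂²` and `∫‖u‖² = ∫‖W‖² + c'²` (`‖c'e₃‖ = |c'|`,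
`PiLp.norm_single`). [folklore] -/
theorem stub_driftAbsorption :
    ∀ (ν : ℝ) (f W : 𝕋³ → E³) (Q : 𝕋³ → ℝ) (c' : ℝ), IsSmooth W → IsSmooth Q → IsDivFree W →
      HasZeroMean W →
      (∀ x, Torus.convect W W x - ν • Torus.laplacian W x + Torus.gradient Q x -
          c' • Torus.partialDeriv (2 : Fin 3) W x = f x) →
      IsClassicalNSSolutionOn Set.univ ν (fun _ => f)
          (fun _ x => W x - c' • EuclideanSpace.single (2 : Fin 3) (1 : ℝ)) (fun _ => Q) ∧
        gradNormSq (fun x => W x - c' • EuclideanSpace.single (2 : Fin 3) (1 : ℝ)) = gradNormSq W ∧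
        MeasureTheory.integral MeasureTheory.volume
            (fun x => ‖W x - c' • EuclideanSpace.single (2 : Fin 3) (1 : ℝ)‖ ^ 2) =
          MeasureTheory.integral MeasureTheory.volume (fun x => ‖W x‖ ^ 2) + c' ^ 2 := by
  intro ν f W Q c' hW hQ hdiv h0 hf
  refine ⟨isClassicalNSSolutionOn_sub_drift hW hQ hdiv hf, gradNormSq_sub_const W _, ?_⟩
  rw [integral_norm_sq_sub_const hW h0, norm_smul, PiLp.norm_single, norm_one, mul_one,
    Real.norm_eq_abs, sq_abs]

end Summit.AnomalousDissipation.AnomalousDissipation.Theorems.NewtonRealisation.DriftAbsorption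
end
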